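import Summits.Langlands.Langlands.Theses.SkinnerWilesDefectOne
import Literature.NumberTheory.Automorphic.OrdinaryCompletedCohomologyGL

/-!
# `ProModularOrdinaryClassical` (stmt-Langlands-12921) — Negative knowledge II: continuous
# `ℚ̄_p`-points of the completed / Hida / ordinary Hecke algebras are integral

From the standing disprover's `Cruxes/ProModularOrdinaryClassical/Disproof.lean` (cdisprove gen 2,
cycle 2, 2026-08-16). The pro-modularity hypothesis of the crux is `∃ 𝒰, 𝒰.IsPadicallyAutomorphic ρ`:
`ρ` is associated with a CONTINUOUS ring homomorphism `x : 𝕋(𝒰) →+* ℚ̄_p` out of the constructed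
completed-cohomology Hecke algebra `𝕋(𝒰) ⊆ ∏_{(r,s,i)} End_{ℤ/p^s}(H^i(X_{U_r}, ℤ/p^s))`; every
surviving round-1 line for the crux replaces it by a continuous point of Hida's algebras
`𝕋^S(𝒰; p) ⊆ ∏ End_ℤ(H^i(X_{U(r)}, ℤ/p^s))` / `𝕋^{S,ord}(𝒰) ⊆ ∏ End_ℤ(H^i(X_{U(r)}, ℤ/p^s)^{ord})`
(`IsIwahoriPadicallyAutomorphic`, `IsOrdinarilyPadicallyAutomorphic`) and a slope condition
(`IsSlopeZeroAt`). This file proves the first STRUCTURAL constraint on all such points that the tree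
can state, with no finiteness, commutativity or automorphic input:

* `norm_apply_le_one_of_continuous_of_natCast_eq_zero` — the abstract fact: if `S` is a subring
  (subspace topology) of a product `∏ᵢ Rᵢ` of topological rings in which `p^{e i} = 0` in `Rᵢ`,
  then every continuous ring homomorphism `x : S → ℚ̄_p` has `‖x t‖ ≤ 1` for all `t`. Proof: `S`
  has a basis of neighbourhoods of `0` made of the ideals "vanish at a finite set `I` of indices";
  `p^N`, `N = max_I e`, lies in such an ideal, so continuity of `x` at `0` bounds `‖x(p^N t)‖ < 1`
  uniformly in `t`; a bounded subring of `ℚ̄_p` is power-bounded, hence in the unit ball.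
* `natCast_endFactor_eq_zero`, `smul_cohomology_modPow_eq_zero`, `natCast_hidaEndFactor_eq_zero`,
  `natCast_ordEndFactor_eq_zero` — the factors are killed by `p^s` (`ℤ/p^s`-linear endomorphisms,
  resp. endomorphisms of the `p^s`-torsion modules `H^i(X_{U(r)}, k/p^s)` and their ordinary parts:
  group cohomology with `p^s`-torsion coefficients is `p^s`-torsion, via cocycles).
* `norm_apply_le_one_of_continuous` (`𝕋(𝒰)`, the crux's own object),
  `norm_apply_le_one_of_continuous_hida` (`𝕋^S(𝒰; p)`), `norm_apply_le_one_of_continuous_ord`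
  (`𝕋^{S,ord}(𝒰)`): continuous `ℚ̄_p`-points are `ℤ̄_p`-valued.
* `norm_hidaT_eq_one_or_lt_one`, `tendsto_pow_factorial_nhds_zero_of_norm_lt_one` — hence the
  "slope dichotomy" of the round-1 lines (`‖x(U_{v,j})‖ = 1`, or `‖x(U_{v,j})‖ < 1` and then
  `x(U_{v,j})^{m!} → 0`) is valuation theory: it carries no automorphic content, the content of a
  line being WHICH branch holds.

Consequences for the disproof effort are drawn in `Disproof.lean` §6 (no "unbounded" junk point of
any of the three Hecke algebras can witness a counterexample; integrality of the eigenvalues is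
automatic on both sides of `IsAssociated`). Mathlib + the two Literature files only. [folklore]
-/

set_option linter.dupNamespace false

namespace Summit.Langlands.Langlands.Theorems.ProModularOrdinaryClassical.Negative

open Literature.NumberTheory.Automorphic Literature.NumberTheory.Automorphic.BigHeckeGLn
open NumberField IsDedekindDomain Filter CategoryTheory groupCohomology Topology

/-! ### The abstract integrality lemma -/

section Abstract

variable {p : ℕ} [Fact p.Prime]

/-- The norm of `p` in `ℚ̄_p` is `p⁻¹`. [folklore] -/
theorem norm_natCast_padicAlgCl : ‖(p : PadicAlgCl p)‖ = (p : ℝ)⁻¹ := by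
  rw [← map_natCast (algebraMap ℚ_[p] (PadicAlgCl p)) p]
  exact (PadicAlgCl.norm_extends (p := p) (p : ℚ_[p])).trans Padic.norm_p

/-- **Continuous `ℚ̄_p`-points of a closed-box subring are bounded.** Let `S` be a subring of a
product `∏ᵢ Rᵢ` of topological rings (subspace of the product topology) such that `p^{e i} = 0` in
`Rᵢ`. Then a continuous ring homomorphism `x : S → ℚ̄_p` is uniformly bounded: `‖x t‖ < p^N` for
some `N` and all `t`. [folklore] -/
theorem exists_norm_apply_lt_of_continuous_of_natCast_eq_zero {ι : Type*} {R : ι → Type*}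
    [∀ i, Ring (R i)] [∀ i, TopologicalSpace (R i)] (S : Subring (∀ i, R i)) (e : ι → ℕ)
    (hkill : ∀ i, ((p ^ e i : ℕ) : R i) = 0) (x : S →+* PadicAlgCl p) (hx : Continuous x) :
    ∃ N : ℕ, ∀ t : S, ‖x t‖ < (p : ℝ) ^ N := by
  have hU : IsOpen ((fun s : S => x s) ⁻¹' Metric.ball (0 : PadicAlgCl p) 1) :=
    hx.isOpen_preimage _ Metric.isOpen_ball
  obtain ⟨V, hV, hVU⟩ := isOpen_induced_iff.1 hU
  have h0 : ((0 : S) : ∀ i, R i) ∈ V := by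
    have h : (0 : S) ∈ (fun s : S => x s) ⁻¹' Metric.ball (0 : PadicAlgCl p) 1 := by simp
    rw [← hVU] at h
    exact h
  obtain ⟨I, u, hu, hIV⟩ := isOpen_pi_iff.1 hV _ h0
  refine ⟨I.sup e, fun s => ?_⟩
  have hp : (0 : ℝ) < (p : ℝ) ^ I.sup e := pow_pos (Nat.cast_pos.2 (Fact.out : p.Prime).pos) _
  have hkillN : ∀ a ∈ I, ((p ^ I.sup e : ℕ) : R a) = 0 := fun a ha => by
    obtain ⟨d, hd⟩ := Nat.exists_eq_add_of_le (Finset.le_sup (f := e) ha)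
    rw [hd, pow_add, Nat.cast_mul, hkill, zero_mul]
  -- `p^N * s` lies in the box, hence in the preimage of the unit ball
  have hmem : ((p ^ I.sup e : ℕ) : S) * s ∈
      (fun s : S => x s) ⁻¹' Metric.ball (0 : PadicAlgCl p) 1 := by
    rw [← hVU]
    refine hIV fun a ha => ?_
    have hcoord : ((((p ^ I.sup e : ℕ) : S) * s : S) : ∀ i, R i) a = 0 := by
      rw [Subring.coe_mul, Pi.mul_apply, Subring.coe_natCast, Pi.natCast_apply, hkillN a ha,
        zero_mul]
    rw [hcoord]
    simpa using (hu a ha).2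
  have hlt : ‖x (((p ^ I.sup e : ℕ) : S) * s)‖ < 1 := by simpa using hmem
  rw [map_mul, map_natCast, Nat.cast_pow, norm_mul, norm_pow, norm_natCast_padicAlgCl, inv_pow] at hlt
  rwa [inv_mul_lt_iff₀ hp, mul_one] at hlt

/-- **Continuous `ℚ̄_p`-points of a closed-box subring are integral**: in the situation of
`exists_norm_apply_lt_of_continuous_of_natCast_eq_zero`, `‖x t‖ ≤ 1` for every `t` (a bounded
subring of `ℚ̄_p` is power-bounded; the norm is multiplicative). [folklore] -/
theorem norm_apply_le_one_of_continuous_of_natCast_eq_zero {ι : Type*} {R : ι → Type*}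
    [∀ i, Ring (R i)] [∀ i, TopologicalSpace (R i)] (S : Subring (∀ i, R i)) (e : ι → ℕ)
    (hkill : ∀ i, ((p ^ e i : ℕ) : R i) = 0) (x : S →+* PadicAlgCl p) (hx : Continuous x)
    (t : S) : ‖x t‖ ≤ 1 := by
  obtain ⟨N, hN⟩ := exists_norm_apply_lt_of_continuous_of_natCast_eq_zero S e hkill x hx
  by_contra h
  push Not at h
  obtain ⟨k, hk⟩ :=
    ((tendsto_pow_atTop_atTop_of_one_lt h).eventually_gt_atTop ((p : ℝ) ^ N)).exists
  have := hN (t ^ k)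
  rw [map_pow, norm_pow] at this
  exact lt_asymm hk this

/-- In a normed ring, `‖a‖ < 1` forces `a^{m!} → 0` (the positive-slope branch of the slope
dichotomy). [folklore] -/
theorem tendsto_pow_factorial_nhds_zero_of_norm_lt_one {A : Type*} [NormedRing A] {a : A}
    (ha : ‖a‖ < 1) : Tendsto (fun m : ℕ => a ^ m.factorial) atTop (𝓝 0) :=
  (tendsto_pow_atTop_nhds_zero_of_norm_lt_one ha).comp factorial_tendsto_atTop

end Abstract

/-! ### The factors of the three Hecke products are killed by `p^s` -/

section Factors

/-- **Group cohomology with `ϖ^t`-torsion coefficients is `ϖ^t`-torsion**: on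
`H^i(X_L, k/ϖ^t) = H^i(Γ, Fun(𝒢/L, k/ϖ^t))` the scalar `ϖ^t` acts by zero (it kills every cochain).
[folklore] -/
theorem smul_cohomology_modPow_eq_zero {k : Type} [CommRing k] {Γ 𝒢 : Type} [Group Γ] [Group 𝒢]
    (ι : Γ →* 𝒢) (L : Subgroup 𝒢) (ϖ : k) (t i : ℕ)
    (h : ArithmeticQuotient.cohomology k ι L (modPow k ϖ t) i) : ϖ ^ t • h = 0 := by
  have hc : ∀ a : ArithmeticQuotient.coeffRep k ι L (modPow k ϖ t), ϖ ^ t • a = 0 := by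
    intro a
    funext q
    change ϖ ^ t • a q = 0
    obtain ⟨y, hy⟩ := Ideal.Quotient.mk_surjective (a q)
    rw [← hy, ← Ideal.Quotient.mk_eq_mk, ← Submodule.Quotient.mk_smul, Submodule.Quotient.mk_eq_zero,
      smul_eq_mul]
    exact Ideal.mul_mem_right y _ (Ideal.mem_span_singleton_self _)
  induction h using groupCohomology_induction_on with
  | h z =>
    have hz : ϖ ^ t • z = 0 := by
      apply (ModuleCat.mono_iff_injective (iCocycles _ i)).1 inferInstance
      rw [map_smul, map_zero]
      funext g
      exact hc _
    rw [← map_smul, hz, map_zero]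

variable {n : ℕ} {K : Type} [Field K] [NumberField K] {p : ℕ} [Fact p.Prime] (𝒰 : TameLevel n K p)

/-- In the factor `End_{ℤ/p^s}(H^i(X_{U_r}, ℤ/p^s))` of the product carrying `𝕋(𝒰)` (index
`idx = (r, s, i)`), `p^s = 0`. [folklore] -/
theorem natCast_endFactor_eq_zero (idx : ℕ × ℕ × ℕ) : ((p ^ idx.2.1 : ℕ) : 𝒰.EndFactor idx) = 0 := by
  change ((p ^ idx.2.1 : ℕ) : Module.End (ZMod (p ^ idx.2.1))
    (levelCohomology (𝒰.tower idx.1) (ZMod (p ^ idx.2.1)) idx.2.2)) = 0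
  refine LinearMap.ext fun m => ?_
  rw [Module.End.natCast_apply, LinearMap.zero_apply, ← Nat.cast_smul_eq_nsmul (ZMod (p ^ idx.2.1)),
    ZMod.natCast_self, zero_smul]

variable (k : Type) [CommRing k]

/-- In the factor `End_k(H^i(X_{U(r)}, k/p^t))` of the product carrying the Hida Hecke algebra
`𝕋^S(𝒰; p)_k` (index `x = (i, r, t)`), `p^t = 0`. [folklore] -/
theorem natCast_hidaEndFactor_eq_zero (x : TowerIndex) : ((p ^ x.2.2 : ℕ) : 𝒰.HidaEndFactor k x) = 0 := by
  change ((p ^ x.2.2 : ℕ) : Module.End k (𝒰.hidaCohomology k x)) = 0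
  refine LinearMap.ext fun m => ?_
  rw [Module.End.natCast_apply, LinearMap.zero_apply, ← Nat.cast_smul_eq_nsmul k, Nat.cast_pow]
  exact smul_cohomology_modPow_eq_zero (globalEmbedding n K) (𝒰.hidaTower.level x.2.1) (p : k) x.2.2 x.1 m

/-- In the factor `End_k(H^i(X_{U(r)}, k/p^t)^{ord})` of the product carrying the ordinary Hecke
algebra `𝕋^{S,ord}(𝒰)_k` (index `x = (i, r, t)`), `p^t = 0`. [folklore] -/
theorem natCast_ordEndFactor_eq_zero (x : TowerIndex) : ((p ^ x.2.2 : ℕ) : 𝒰.OrdEndFactor k x) = 0 := by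
  change ((p ^ x.2.2 : ℕ) : Module.End k (𝒰.ordinaryPart k x)) = 0
  refine LinearMap.ext fun m => ?_
  rw [Module.End.natCast_apply, LinearMap.zero_apply, ← Nat.cast_smul_eq_nsmul k, Nat.cast_pow]
  apply Subtype.ext
  rw [Submodule.coe_smul, Submodule.coe_zero]
  exact smul_cohomology_modPow_eq_zero (globalEmbedding n K) (𝒰.hidaTower.level x.2.1) (p : k) x.2.2 x.1 m

end Factors

/-! ### Integrality of continuous points of `𝕋(𝒰)`, `𝕋^S(𝒰; p)`, `𝕋^{S,ord}(𝒰)` -/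

section Points

variable {n : ℕ} {K : Type} [Field K] [NumberField K] {p : ℕ} [Fact p.Prime] (𝒰 : TameLevel n K p)

/-- **Continuous `ℚ̄_p`-points of the completed-cohomology Hecke algebra are integral**: every
continuous ring homomorphism `x : 𝕋(𝒰) → ℚ̄_p` satisfies `‖x t‖ ≤ 1` for all `t` — any rank `n`,
number field `K`, prime `p`, tame level `𝒰`; no finiteness or commutativity input. In particular
the eigenvalues `x(T_{v,i})` of a `p`-adically automorphic eigensystem
(`TameLevel.IsPadicallyAutomorphic`, hypothesis H3 of the crux) lie in `ℤ̄_p`. [folklore] -/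
theorem norm_apply_le_one_of_continuous (x : CompletedCohomologyHeckeAlgebraGLn 𝒰 →+* PadicAlgCl p)
    (hx : Continuous x) (t : CompletedCohomologyHeckeAlgebraGLn 𝒰) : ‖x t‖ ≤ 1 :=
  norm_apply_le_one_of_continuous_of_natCast_eq_zero 𝒰.bigHeckeSubring (fun idx => idx.2.1)
    (natCast_endFactor_eq_zero 𝒰) x hx t

/-- **Continuous `ℚ̄_p`-points of the Hida-tower Hecke algebra `𝕋^S(𝒰; p)` are integral**
(`IsIwahoriPadicallyAutomorphic`; in particular `‖x(U_{v,j})‖ ≤ 1` and `‖x(⟨u⟩_v)‖ ≤ 1`).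
[folklore] -/
theorem norm_apply_le_one_of_continuous_hida (x : HidaHeckeAlgebraGLn 𝒰 →+* PadicAlgCl p)
    (hx : Continuous x) (t : HidaHeckeAlgebraGLn 𝒰) : ‖x t‖ ≤ 1 :=
  norm_apply_le_one_of_continuous_of_natCast_eq_zero (𝒰.hidaHeckeSubring ℤ) (fun y => y.2.2)
    (natCast_hidaEndFactor_eq_zero 𝒰 ℤ) x hx t

/-- **Continuous `ℚ̄_p`-points of Hida's ordinary Hecke algebra `𝕋^{S,ord}(𝒰)` are integral**
(`IsOrdinarilyPadicallyAutomorphic`, the conclusion of the foreseen `OrdinaryFactorisation`).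
[folklore] -/
theorem norm_apply_le_one_of_continuous_ord (x : OrdinaryHeckeAlgebraGLn 𝒰 →+* PadicAlgCl p)
    (hx : Continuous x) (t : OrdinaryHeckeAlgebraGLn 𝒰) : ‖x t‖ ≤ 1 :=
  norm_apply_le_one_of_continuous_of_natCast_eq_zero (𝒰.ordHeckeSubring ℤ) (fun y => y.2.2)
    (natCast_ordEndFactor_eq_zero 𝒰 ℤ) x hx t

/-- **The slope dichotomy is valuation theory.** For a continuous `ℚ̄_p`-point `x` of `𝕋^S(𝒰; p)`
and any `w, j`: either `‖x(T_{w,j})‖ = 1` (for `w ∣ p`: "slope zero at `w`", the unit branch of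
`IsSlopeZeroAt`) or `‖x(T_{w,j})‖ < 1`, in which case `x(T_{w,j})^{m!} → 0`
(`tendsto_pow_factorial_nhds_zero_of_norm_lt_one`). Nothing automorphic is used: the content of a
"Galois-ordinary ⇒ Hecke-ordinary" line is entirely in deciding the branch. [folklore] -/
theorem norm_hidaT_eq_one_or_lt_one (x : HidaHeckeAlgebraGLn 𝒰 →+* PadicAlgCl p) (hx : Continuous x)
    (w : HeightOneSpectrum (𝓞 K)) (j : ℕ) :
    ‖x (𝒰.hidaT w j)‖ = 1 ∨
      (‖x (𝒰.hidaT w j)‖ < 1 ∧ Tendsto (fun m : ℕ => x (𝒰.hidaT w j) ^ m.factorial) atTop (𝓝 0)) := by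
  rcases (norm_apply_le_one_of_continuous_hida 𝒰 x hx (𝒰.hidaT w j)).eq_or_lt with h | h
  · exact Or.inl h
  · exact Or.inr ⟨h, tendsto_pow_factorial_nhds_zero_of_norm_lt_one h⟩

end Points

end Summit.Langlands.Langlands.Theorems.ProModularOrdinaryClassical.Negative
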